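import Summits.NavierStokesRegularity.FluidComputer.SummedOccupationBridge
import Summits.NavierStokesRegularity.FluidComputer.VorticityOccupationWindow
import HarnessLib

/-!
# Fluid computer — the SUMMED LEVEL-OCCUPATION of a blow-up diverges in every terminal window, above every
# level (ν ≥ 0: Euler included; unconditional)

HONEST FRAMING (cell `pub-fluidc`, verbatim): *low prior, high value-of-information experiment on Tao's
machine paradigm; NOT a claim that NS blows up.* Theorem side of the cell; nothing here is evidence of blow-up.

The rung's occupation/clock currency (RULING R35 F6, R37 (ii): `O = k · U · τ`, wavenumber × amplitude × residence)
has so far two typed floors: the CONDITIONAL constant floor of `LevelOccupationFloor` / `OccupationWindowFloor`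
(`O_q > c` at infinitely many levels `q`, conditional on Cheskidov–Dai's criterion — a published theorem carried
as a named fact not yet proved in the tree —, `ν > 0`) and the UNCONDITIONAL
but un-levelled vorticity occupation of `VorticityOccupationWindow` (`∫_{(t₀,T)} ‖ω‖_∞ = ∞`, `ν ≥ 0`, Beale–Kato–Majda,
discharged in the tree). With the Littlewood–Paley sum bridge `sup_x ‖curl u‖ ≤ C Σ_j 2^j ‖Δ̇_j u‖_∞`
(`SummedOccupationBridge.exists_iSup_curl_le_tsum`) the second becomes a LEVELLED, UNCONDITIONAL floor. For a classical
solution `(u, p)` of the unforced Navier–Stokes (`ν > 0`) or Euler (`ν = 0`) system on `ℝ³ × [0, T)` in the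
Beale–Kato–Majda class on every `[0, T'']`, `T'' < T`, which does not continue in the class past `T` (in particular
every maximal smooth solution of the cell, `IsMaximalSmoothSolution`), and every `t₀ ∈ [0, T)`:

* `tsum_occupation_eq_top` (`_of_maximal`) — `Σ_{j ∈ ℤ} 2^j ∫_{(t₀,T)} ‖Δ̇_j u(t)‖_{L^∞} dt = ∞`: the summed
  amplitude-weighted residence `Σ_n k_n ∫ U_n dt` over the levels is infinite inside every terminal window (BKM in the
  window + the bridge slice by slice + Tonelli, `SummedOccupationBridge.aemeasurable_blockSup`);
* `exists_lintegral_blockSup_le` — yet EACH level's window occupation is finite and small at low levels: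
  `∫_{(t₀,T)} ‖Δ̇_j u‖_∞ ≤ C 2^{3j/2} ‖u(0)‖₂ (T − t₀)` (Bernstein `L² → L^∞` + energy decay, `ν ≥ 0`);
* `tsum_occupation_below_lt_top` — and the levels BELOW any `J` carry a finite total, `Σ_{j<J} 2^j ∫_{(t₀,T)} U_j < ∞`
  (geometric series; no blow-up hypothesis);
* `tsum_occupation_tail_eq_top` (`_nat` on the cell's `ℕ`-levels `k_q = 2^q`) — hence EVERY TAIL diverges:
  `Σ_{n ≥ 0} 2^{J+n} ∫_{(t₀,T)} ‖Δ̇_{J+n} u‖_∞ = ∞` for every level `J` — the occupation of a blow-up is delivered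
  UPWARD (above every level) and FORWARD (inside every terminal window) without end, for Euler as for Navier–Stokes;
* `frequently_lt_occupation` — the clock reading: for every summable gauge `b` (`Σ_q b_q < ∞`, e.g. `ε 2^{-δq}`), the
  window occupation `2^q ∫_{(t₀,T)} ‖Δ̇_q u‖_∞` exceeds `b_q` at INFINITELY MANY levels `q` (the conditional floor of
  `OccupationWindowFloor` has the constant gauge `c`; this one is unconditional with any summable gauge);
* `frequently_lt_peak_occupation` — the same in the shape of the atlas's occupation companion `O = k · U_pk · τ`
  (RULING R35 F6): `2^q · sup_{(t₀,T)} ‖Δ̇_q u‖_∞ · (T − t₀) > b_q` at infinitely many `q`, in every terminal window;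
* `tail_and_gauge_of_maximal` — tail and gauge readings for `IsMaximalSmoothSolution ν 0 u p T`, `ν ≥ 0`.

Analytically the floor is Beale–Kato–Majda read level by level: `Σ_j 2^j ‖Δ̇_j u‖_∞` is the `Ḃ¹_{∞,1}` norm, so
`tsum_occupation_eq_top` says `∫_{(t₀,T)} ‖u(t)‖_{Ḃ¹_{∞,1}} dt = ∞` — WEAKER than BKM itself and than the
`Ḃ⁰_{∞,∞}`-vorticity refinement of Kozono–Ogawa–Taniuchi (not used, not claimed); what the cell uses is the levelled
bookkeeping (tails, gauges, windows), not a sharper criterion.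

Cascade words (hedged reading, as in the sibling files): a computed segment whose summed level occupation
`Σ_{n ≥ J} k_n U_n τ_n` stays bounded above some level `J` in some late window is not a blow-up segment — a
one-shot focusing event that hands nothing upward (RULING R34/R37 (i)) is the extreme case. Necessity only.
Not here: per-level constant floors without Cheskidov–Dai (open); torus versions; sharp-band statements.
0 sorry; no new definitions or named facts (inputs: the discharged BKM theorem, the tree's Littlewood–Paley theory).

## References

* J. T. Beale, T. Kato, A. Majda, Comm. Math. Phys. 94 (1984) 61–66, Thm. 1. [BealeKatoMajda1984]
* H. Bahouri, J.-Y. Chemin, R. Danchin, *Fourier Analysis and Nonlinear PDE*, Springer 2011, Lemma 2.1.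
  [BahouriCheminDanchin2011]
-/

noncomputable section

open MeasureTheory Set Function Filter Topology
open scoped ENNReal NNReal
open Literature.Analysis.FluidPDE Literature.Analysis.FunctionSpaces
open Summit.NavierStokesRegularity.FluidComputer.SummedOccupationBridge

namespace Summit.NavierStokesRegularity.FluidComputer.SummedOccupationFloor

/-! ## §3 The summed level-occupation floor -/

/-- **THE SUMMED LEVEL-OCCUPATION OF A BLOW-UP DIVERGES IN EVERY TERMINAL WINDOW** (`ν ≥ 0`: Euler
included). Let `(u, p)` be a classical solution of the unforced Navier–Stokes (`ν > 0`) or Euler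
(`ν = 0`) system on `ℝ³ × [0, T)`, `T > 0`, in the Beale–Kato–Majda class on every `[0, T'']`, `T'' < T`,
which does NOT continue in the class past `T`. Then for every `t₀ ∈ [0, T)`:
`∑_{j ∈ ℤ} 2^j ∫_{(t₀,T)} ‖Δ̇_j u(t)‖_{L^∞} dt = ∞` — in cascade words `Σ_n k_n · U_n · τ_n = ∞` over
the levels, with the amplitude-weighted residence `U_n τ_n := ∫ U_n dt` read INSIDE the terminal
window. Proof: BKM in the window (`VorticityOccupationWindow.lintegral_iSup_curl_window_eq_top`),
the LP-sum bridge `sup_x ‖curl u(t)‖ ≤ C Σ_j 2^j ‖Δ̇_j u(t)‖_∞` (`exists_iSup_curl_le_tsum`) slice by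
slice, and Tonelli (`aemeasurable_blockSup`). [cite: BealeKatoMajda1984, Theorem 1] -/
theorem tsum_occupation_eq_top {ν : ℝ} (hν : 0 ≤ ν) {T : ℝ} (hT : 0 < T)
    {u : ℝ → EuclideanSpace ℝ (Fin 3) → EuclideanSpace ℝ (Fin 3)} {p : ℝ → EuclideanSpace ℝ (Fin 3) → ℝ}
    (hsol : IsClassicalNSSolutionOn (Ico 0 T) ν 0 u p)
    (hreg : ∀ T'' < T, HasBoundedSobolevNormsOn (Icc 0 T'') u)
    (hmax : ¬ HasSobolevExtensionPast ν u T) {t₀ : ℝ} (ht₀ : t₀ ∈ Ico 0 T) :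
    ∑' j : ℤ, (2 : ℝ≥0∞) ^ j * ∫⁻ t in Ioo t₀ T, eLpNorm (blockFn j (u t)) ∞ volume = ∞ := by
  obtain ⟨C, hC⟩ := exists_iSup_curl_le_tsum
  have hbkm := VorticityOccupationWindow.lintegral_iSup_curl_window_eq_top hν hT hsol hreg hmax ht₀
  have hle : ∀ t ∈ Ioo t₀ T, (⨆ x, ‖curl (u t) x‖ₑ) ≤
      C * ∑' j : ℤ, (2 : ℝ≥0∞) ^ j * eLpNorm (blockFn j (u t)) ∞ volume := fun t ht =>
    hC (u t) (isSmoothL2Field_slice hsol hreg ⟨ht₀.1.trans ht.1.le, ht.2⟩)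
  have hmeas : ∀ j : ℤ, AEMeasurable
      (fun t => (2 : ℝ≥0∞) ^ j * eLpNorm (blockFn j (u t)) ∞ volume) (volume.restrict (Ioo t₀ T)) :=
    fun j => (aemeasurable_blockSup hsol hreg j ht₀.1).const_mul _
  have h1 : (∫⁻ t in Ioo t₀ T, ⨆ x, ‖curl (u t) x‖ₑ) ≤
      C * ∑' j : ℤ, (2 : ℝ≥0∞) ^ j * ∫⁻ t in Ioo t₀ T, eLpNorm (blockFn j (u t)) ∞ volume :=
    calc (∫⁻ t in Ioo t₀ T, ⨆ x, ‖curl (u t) x‖ₑ)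
        ≤ ∫⁻ t in Ioo t₀ T, C * ∑' j : ℤ, (2 : ℝ≥0∞) ^ j * eLpNorm (blockFn j (u t)) ∞ volume :=
          setLIntegral_mono' measurableSet_Ioo hle
      _ = C * ∑' j : ℤ, ∫⁻ t in Ioo t₀ T, (2 : ℝ≥0∞) ^ j * eLpNorm (blockFn j (u t)) ∞ volume := by
          rw [lintegral_const_mul' _ _ ENNReal.coe_ne_top, lintegral_tsum hmeas]
      _ = C * ∑' j : ℤ, (2 : ℝ≥0∞) ^ j * ∫⁻ t in Ioo t₀ T, eLpNorm (blockFn j (u t)) ∞ volume := by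
          congr 1
          exact tsum_congr fun j => lintegral_const_mul'' _ (aemeasurable_blockSup hsol hreg j ht₀.1)
  rw [hbkm, top_le_iff] at h1
  rcases ENNReal.mul_eq_top.1 h1 with h | h
  · exact h.2
  · exact absurd h.1 ENNReal.coe_ne_top

/-- **The same for the cell's maximal smooth solutions** (`IsMaximalSmoothSolution ν 0 u p T`), `ν ≥ 0`,
in the BKM class on compact sub-intervals: `∑_{j ∈ ℤ} 2^j ∫_{(t₀,T)} ‖Δ̇_j u(t)‖_∞ dt = ∞` for every
`t₀ ∈ [0, T)`. [cite: BealeKatoMajda1984, Theorem 1] -/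
theorem tsum_occupation_eq_top_of_maximal {ν : ℝ} (hν : 0 ≤ ν) {T : ℝ} (hT : 0 < T)
    {u : ℝ → EuclideanSpace ℝ (Fin 3) → EuclideanSpace ℝ (Fin 3)} {p : ℝ → EuclideanSpace ℝ (Fin 3) → ℝ}
    (hmax : IsMaximalSmoothSolution ν 0 u p T)
    (hreg : ∀ T'' < T, HasBoundedSobolevNormsOn (Icc 0 T'') u) {t₀ : ℝ} (ht₀ : t₀ ∈ Ico 0 T) :
    ∑' j : ℤ, (2 : ℝ≥0∞) ^ j * ∫⁻ t in Ioo t₀ T, eLpNorm (blockFn j (u t)) ∞ volume = ∞ :=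
  tsum_occupation_eq_top hν hT hmax.1 hreg (fun hext => hmax.2 hext.hasSmoothExtensionPast) ht₀

/-- **Each level's window occupation is finite, and small at low levels** (Bernstein `L² → L^∞` on the
blocks, tree `exists_eLpNorm_top_blockFn_le`, and the energy inequality `eLpNorm_two_slice_le`): with an
absolute `C`, `∫_{(t₀,T)} ‖Δ̇_j u(t)‖_∞ dt ≤ C · 2^{3j/2} · ‖u(0)‖_{L²} · (T - t₀)` for `ν ≥ 0`, every
classical solution on `[0, T)` in the BKM class on compact sub-intervals, every `j ∈ ℤ` and `t₀ ≥ 0`. So no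
single level carries the divergence of `tsum_occupation_eq_top`: it is collective, and — the low levels being
summable — delivered by the HIGH levels (`tsum_occupation_tail_eq_top`). [cite: BahouriCheminDanchin2011, Lemma 2.1] -/
theorem exists_lintegral_blockSup_le :
    ∃ C : ℝ≥0, ∀ (ν T : ℝ), 0 ≤ ν →
      ∀ (u : ℝ → EuclideanSpace ℝ (Fin 3) → EuclideanSpace ℝ (Fin 3)) (p : ℝ → EuclideanSpace ℝ (Fin 3) → ℝ),
      IsClassicalNSSolutionOn (Ico 0 T) ν 0 u p → (∀ T'' < T, HasBoundedSobolevNormsOn (Icc 0 T'') u) →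
      ∀ (j : ℤ) (t₀ : ℝ), 0 ≤ t₀ →
        (∫⁻ t in Ioo t₀ T, eLpNorm (blockFn j (u t)) ∞ volume) ≤
          C * (2 : ℝ≥0∞) ^ ((j : ℝ) * (3 / 2)) * eLpNorm (u 0) 2 volume * ENNReal.ofReal (T - t₀) := by
  obtain ⟨C, hC⟩ := exists_eLpNorm_top_blockFn_le (E := EuclideanSpace ℝ (Fin 3)) (ι := Fin 3)
  refine ⟨C, fun ν T hν u p hsol hreg j t₀ ht₀ => ?_⟩
  have hexp : ((j : ℝ)) * Module.finrank ℝ (EuclideanSpace ℝ (Fin 3)) * 2⁻¹ = (j : ℝ) * (3 / 2) := by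
    rw [finrank_euclideanSpace_fin]; push_cast; ring
  have hle : ∀ t ∈ Ioo t₀ T, eLpNorm (blockFn j (u t)) ∞ volume ≤
      C * (2 : ℝ≥0∞) ^ ((j : ℝ) * (3 / 2)) * eLpNorm (u 0) 2 volume := fun t ht => by
    have ht' : t ∈ Ico 0 T := ⟨ht₀.trans ht.1.le, ht.2⟩
    have h1 := hC j (u t) (isSmoothL2Field_slice hsol hreg ht').memLp_two
    rw [hexp] at h1
    exact h1.trans (by gcongr; exact eLpNorm_two_slice_le hν hsol hreg ht')
  calc (∫⁻ t in Ioo t₀ T, eLpNorm (blockFn j (u t)) ∞ volume)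
      ≤ ∫⁻ _ in Ioo t₀ T, C * (2 : ℝ≥0∞) ^ ((j : ℝ) * (3 / 2)) * eLpNorm (u 0) 2 volume :=
        setLIntegral_mono' measurableSet_Ioo hle
    _ = C * (2 : ℝ≥0∞) ^ ((j : ℝ) * (3 / 2)) * eLpNorm (u 0) 2 volume * ENNReal.ofReal (T - t₀) := by
        rw [setLIntegral_const, Real.volume_Ioo]

/-- **The occupation BELOW any level is finite** (no blow-up hypothesis): for `ν ≥ 0`, a classical solution on
`[0, T)`, `T > 0`, in the BKM class on compact sub-intervals, every `t₀ ≥ 0` and every level `J ∈ ℤ`,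
`∑_{n ∈ ℕ} 2^{J-1-n} ∫_{(t₀,T)} ‖Δ̇_{J-1-n} u(t)‖_∞ dt ≤ C ‖u(0)‖₂ (T - t₀) Σ_n 2^{(5/2)(J-1-n)} < ∞`
(`exists_lintegral_blockSup_le`, geometric series). [cite: BahouriCheminDanchin2011, Lemma 2.1] -/
theorem tsum_occupation_below_lt_top {ν : ℝ} (hν : 0 ≤ ν) {T : ℝ} (hT : 0 < T)
    {u : ℝ → EuclideanSpace ℝ (Fin 3) → EuclideanSpace ℝ (Fin 3)} {p : ℝ → EuclideanSpace ℝ (Fin 3) → ℝ}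
    (hsol : IsClassicalNSSolutionOn (Ico 0 T) ν 0 u p)
    (hreg : ∀ T'' < T, HasBoundedSobolevNormsOn (Icc 0 T'') u) {t₀ : ℝ} (ht₀ : 0 ≤ t₀) (J : ℤ) :
    ∑' n : ℕ, (2 : ℝ≥0∞) ^ (J - 1 - n) *
        ∫⁻ t in Ioo t₀ T, eLpNorm (blockFn (J - 1 - n) (u t)) ∞ volume < ∞ := by
  obtain ⟨C, hC⟩ := exists_lintegral_blockSup_le
  set E : ℝ≥0∞ := eLpNorm (u 0) 2 volume with hE
  have hEtop : E < ∞ := (isSmoothL2Field_slice hsol hreg ⟨le_rfl, hT⟩).memLp_two.eLpNorm_lt_top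
  set r : ℝ≥0∞ := (2 : ℝ≥0∞) ^ (-(5 / 2 : ℝ)) with hr
  have hr1 : r < 1 := ENNReal.rpow_lt_one_of_one_lt_of_neg (by norm_num) (by norm_num)
  set K : ℝ≥0∞ := C * (2 : ℝ≥0∞) ^ (((J : ℝ) - 1) * (5 / 2)) * E * ENNReal.ofReal (T - t₀) with hK
  have hKtop : K < ∞ := by
    refine ENNReal.mul_lt_top (ENNReal.mul_lt_top (ENNReal.mul_lt_top ENNReal.coe_lt_top ?_) hEtop)
      ENNReal.ofReal_lt_top
    exact lt_top_iff_ne_top.2 (by simp [ENNReal.rpow_eq_top_iff])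
  have hle : ∀ n : ℕ, (2 : ℝ≥0∞) ^ (J - 1 - n) *
      (∫⁻ t in Ioo t₀ T, eLpNorm (blockFn (J - 1 - n) (u t)) ∞ volume) ≤ K * r ^ n := by
    intro n
    have hj : (((J - 1 - n : ℤ)) : ℝ) = (J : ℝ) - 1 - n := by push_cast; ring
    have hpow : (2 : ℝ≥0∞) ^ (J - 1 - n : ℤ) * (2 : ℝ≥0∞) ^ ((((J - 1 - n : ℤ)) : ℝ) * (3 / 2)) =
        (2 : ℝ≥0∞) ^ (((J : ℝ) - 1) * (5 / 2)) * r ^ n := by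
      rw [← ENNReal.rpow_intCast, hj, ← ENNReal.rpow_add _ _ two_ne_zero ENNReal.ofNat_ne_top, hr,
        ← ENNReal.rpow_natCast, ← ENNReal.rpow_mul,
        ← ENNReal.rpow_add _ _ two_ne_zero ENNReal.ofNat_ne_top]
      congr 1
      ring
    calc (2 : ℝ≥0∞) ^ (J - 1 - n : ℤ) * (∫⁻ t in Ioo t₀ T, eLpNorm (blockFn (J - 1 - n) (u t)) ∞ volume)
        ≤ (2 : ℝ≥0∞) ^ (J - 1 - n : ℤ) *
            (C * (2 : ℝ≥0∞) ^ ((((J - 1 - n : ℤ)) : ℝ) * (3 / 2)) * E * ENNReal.ofReal (T - t₀)) := by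
          gcongr
          exact hC ν T hν u p hsol hreg _ t₀ ht₀
      _ = ((2 : ℝ≥0∞) ^ (J - 1 - n : ℤ) *
            (2 : ℝ≥0∞) ^ ((((J - 1 - n : ℤ)) : ℝ) * (3 / 2))) * (C * E * ENNReal.ofReal (T - t₀)) := by
          ring
      _ = ((2 : ℝ≥0∞) ^ (((J : ℝ) - 1) * (5 / 2)) * r ^ n) * (C * E * ENNReal.ofReal (T - t₀)) := by
          rw [hpow]
      _ = K * r ^ n := by
          rw [hK]
          ring
  calc ∑' n : ℕ, (2 : ℝ≥0∞) ^ (J - 1 - n) *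
          ∫⁻ t in Ioo t₀ T, eLpNorm (blockFn (J - 1 - n) (u t)) ∞ volume
      ≤ ∑' n : ℕ, K * r ^ n := ENNReal.tsum_le_tsum hle
    _ = K * (1 - r)⁻¹ := by rw [ENNReal.tsum_mul_left, ENNReal.tsum_geometric]
    _ < ∞ := ENNReal.mul_lt_top hKtop (ENNReal.inv_lt_top.2 (tsub_pos_of_lt hr1))

/-- **THE DIVERGENCE SITS AT ARBITRARILY HIGH LEVELS: every tail diverges.** In the setting of
`tsum_occupation_eq_top` (`ν ≥ 0`), for every `t₀ ∈ [0, T)` and EVERY level `J ∈ ℤ`: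
`∑_{n ∈ ℕ} 2^{J+n} ∫_{(t₀,T)} ‖Δ̇_{J+n} u(t)‖_{L^∞} dt = ∞` — the levels below `J` carry only a finite amount
(`tsum_occupation_below_lt_top`). In cascade words: the summed occupation `Σ_{n ≥ J} k_n U_n τ_n` of a blow-up is
infinite above every level AND inside every terminal window — it is delivered UPWARD and FORWARD without end,
unconditionally and for Euler as for Navier–Stokes (the viscous theory adds the per-level floors of
`LevelReynoldsFloor` / `OccupationWindowFloor`). [cite: BealeKatoMajda1984, Theorem 1] -/
theorem tsum_occupation_tail_eq_top {ν : ℝ} (hν : 0 ≤ ν) {T : ℝ} (hT : 0 < T)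
    {u : ℝ → EuclideanSpace ℝ (Fin 3) → EuclideanSpace ℝ (Fin 3)} {p : ℝ → EuclideanSpace ℝ (Fin 3) → ℝ}
    (hsol : IsClassicalNSSolutionOn (Ico 0 T) ν 0 u p)
    (hreg : ∀ T'' < T, HasBoundedSobolevNormsOn (Icc 0 T'') u)
    (hmax : ¬ HasSobolevExtensionPast ν u T) {t₀ : ℝ} (ht₀ : t₀ ∈ Ico 0 T) (J : ℤ) :
    ∑' n : ℕ, (2 : ℝ≥0∞) ^ (J + n) *
        ∫⁻ t in Ioo t₀ T, eLpNorm (blockFn (J + n) (u t)) ∞ volume = ∞ := by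
  set a : ℤ → ℝ≥0∞ := fun j =>
    (2 : ℝ≥0∞) ^ j * ∫⁻ t in Ioo t₀ T, eLpNorm (blockFn j (u t)) ∞ volume with ha
  have htot : ∑' j, a j = ∞ := tsum_occupation_eq_top hν hT hsol hreg hmax ht₀
  -- shift by `J` and split `ℤ = ℕ ⊔ (-ℕ - 1)`
  have hshift : ∑' k : ℤ, a (k + J) = ∑' j, a j := (Equiv.addRight J).tsum_eq a
  have hsplit : ∑' k : ℤ, a (k + J) =
      ∑' n : ℕ, a ((n : ℤ) + J) + ∑' n : ℕ, a (-((n : ℤ) + 1) + J) :=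
    tsum_of_nat_of_neg_add_one (f := fun k : ℤ => a (k + J)) ENNReal.summable ENNReal.summable
  -- the head (levels `< J`) is finite
  have hhead : ∑' n : ℕ, a (-((n : ℤ) + 1) + J) < ∞ := by
    refine lt_of_eq_of_lt (tsum_congr fun n => ?_) (tsum_occupation_below_lt_top hν hT hsol hreg ht₀.1 J)
    rw [show (-((n : ℤ) + 1) + J) = J - 1 - n by ring, ha]
  -- conclude
  rw [← hshift, hsplit] at htot
  rcases ENNReal.add_eq_top.1 htot with h | h
  · refine Eq.trans (tsum_congr fun n => ?_) h
    rw [add_comm J (n : ℤ), ha]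
  · exact absurd h hhead.ne

/-- **The tail floor on the cell's `ℕ`-indexed levels** (`k_q = 2^q`, `q ∈ ℕ`, as in `LevelOccupationFloor`):
for every `J ∈ ℕ` and every `t₀ ∈ [0, T)`, `∑_{q ∈ ℕ} 2^{J+q} ∫_{(t₀,T)} ‖Δ̇_{J+q} u(t)‖_∞ dt = ∞`
(`ν ≥ 0`). [cite: BealeKatoMajda1984, Theorem 1] -/
theorem tsum_occupation_tail_eq_top_nat {ν : ℝ} (hν : 0 ≤ ν) {T : ℝ} (hT : 0 < T)
    {u : ℝ → EuclideanSpace ℝ (Fin 3) → EuclideanSpace ℝ (Fin 3)} {p : ℝ → EuclideanSpace ℝ (Fin 3) → ℝ}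
    (hsol : IsClassicalNSSolutionOn (Ico 0 T) ν 0 u p)
    (hreg : ∀ T'' < T, HasBoundedSobolevNormsOn (Icc 0 T'') u)
    (hmax : ¬ HasSobolevExtensionPast ν u T) {t₀ : ℝ} (ht₀ : t₀ ∈ Ico 0 T) (J : ℕ) :
    ∑' q : ℕ, (2 : ℝ≥0∞) ^ (J + q) *
        ∫⁻ t in Ioo t₀ T, eLpNorm (blockFn ((J + q : ℕ) : ℤ) (u t)) ∞ volume = ∞ := by
  refine Eq.trans (tsum_congr fun q => ?_) (tsum_occupation_tail_eq_top hν hT hsol hreg hmax ht₀ (J : ℤ))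
  rw [← Nat.cast_add, zpow_natCast]

/-- **No summable gauge dominates the level occupations** (the clock reading of the tail floor): in the
setting of `tsum_occupation_eq_top` (`ν ≥ 0`), for every `t₀ ∈ [0, T)` and every sequence `b : ℕ → [0,∞]`
with `Σ_q b_q < ∞` (e.g. `b_q = ε 2^{-δ q}`), the window occupation `2^q ∫_{(t₀,T)} ‖Δ̇_q u(t)‖_∞ dt`
EXCEEDS `b_q` at INFINITELY MANY levels `q`. (Else the occupations would be eventually dominated by `b`,
and a tail of `tsum_occupation_tail_eq_top_nat` would be finite.) Compare the conditional constant floor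
`OccupationWindowFloor.occupation_floor_window` (`> c` at infinitely many levels, under Cheskidov–Dai):
here unconditional, for Euler too, with any summable gauge in place of the constant.
[cite: BealeKatoMajda1984, Theorem 1] -/
theorem frequently_lt_occupation {ν : ℝ} (hν : 0 ≤ ν) {T : ℝ} (hT : 0 < T)
    {u : ℝ → EuclideanSpace ℝ (Fin 3) → EuclideanSpace ℝ (Fin 3)} {p : ℝ → EuclideanSpace ℝ (Fin 3) → ℝ}
    (hsol : IsClassicalNSSolutionOn (Ico 0 T) ν 0 u p)
    (hreg : ∀ T'' < T, HasBoundedSobolevNormsOn (Icc 0 T'') u)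
    (hmax : ¬ HasSobolevExtensionPast ν u T) {t₀ : ℝ} (ht₀ : t₀ ∈ Ico 0 T)
    {b : ℕ → ℝ≥0∞} (hb : ∑' q, b q ≠ ∞) :
    ∃ᶠ q : ℕ in atTop, b q < (2 : ℝ≥0∞) ^ q * ∫⁻ t in Ioo t₀ T, eLpNorm (blockFn (q : ℤ) (u t)) ∞ volume := by
  by_contra hcon
  rw [Filter.not_frequently] at hcon
  simp only [not_lt] at hcon
  obtain ⟨N, hN⟩ := eventually_atTop.1 hcon
  have htail := tsum_occupation_tail_eq_top_nat hν hT hsol hreg hmax ht₀ N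
  have hle : ∑' q : ℕ, (2 : ℝ≥0∞) ^ (N + q) *
      ∫⁻ t in Ioo t₀ T, eLpNorm (blockFn ((N + q : ℕ) : ℤ) (u t)) ∞ volume ≤ ∑' q : ℕ, b (N + q) :=
    ENNReal.tsum_le_tsum fun q => hN (N + q) (Nat.le_add_right N q)
  have hle' : ∑' q : ℕ, b (N + q) ≤ ∑' q, b q :=
    ENNReal.tsum_comp_le_tsum_of_injective (fun q q' h => by simpa using h) b
  exact hb (top_le_iff.1 (htail ▸ hle.trans hle'))

/-- **The floor in the shape of the atlas's occupation companion `O = k · U_pk · τ`** (RULING R35 F6: outer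
wavenumber × PEAK band amplitude × residence time): since `∫_{(t₀,T)} U_q ≤ U_q,pk(t₀,T) · (T - t₀)` with the
window peak `U_q,pk(t₀,T) := sup_{t ∈ (t₀,T)} ‖Δ̇_q u(t)‖_∞`, every summable gauge `b` is beaten by
`2^q · U_q,pk(t₀,T) · (T - t₀)` at INFINITELY MANY levels `q`, in EVERY terminal window `(t₀, T)` (`ν ≥ 0`).
[cite: BealeKatoMajda1984, Theorem 1] -/
theorem frequently_lt_peak_occupation {ν : ℝ} (hν : 0 ≤ ν) {T : ℝ} (hT : 0 < T)
    {u : ℝ → EuclideanSpace ℝ (Fin 3) → EuclideanSpace ℝ (Fin 3)} {p : ℝ → EuclideanSpace ℝ (Fin 3) → ℝ}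
    (hsol : IsClassicalNSSolutionOn (Ico 0 T) ν 0 u p)
    (hreg : ∀ T'' < T, HasBoundedSobolevNormsOn (Icc 0 T'') u)
    (hmax : ¬ HasSobolevExtensionPast ν u T) {t₀ : ℝ} (ht₀ : t₀ ∈ Ico 0 T)
    {b : ℕ → ℝ≥0∞} (hb : ∑' q, b q ≠ ∞) :
    ∃ᶠ q : ℕ in atTop, b q < (2 : ℝ≥0∞) ^ q *
      (⨆ t ∈ Ioo t₀ T, eLpNorm (blockFn (q : ℤ) (u t)) ∞ volume) * ENNReal.ofReal (T - t₀) := by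
  refine (frequently_lt_occupation hν hT hsol hreg hmax ht₀ hb).mono fun q hq => hq.trans_le ?_
  rw [mul_assoc]
  gcongr
  calc (∫⁻ t in Ioo t₀ T, eLpNorm (blockFn (q : ℤ) (u t)) ∞ volume)
      ≤ ∫⁻ _ in Ioo t₀ T, ⨆ s ∈ Ioo t₀ T, eLpNorm (blockFn (q : ℤ) (u s)) ∞ volume :=
        setLIntegral_mono' measurableSet_Ioo fun t ht =>
          le_iSup₂ (f := fun s (_ : s ∈ Ioo t₀ T) => eLpNorm (blockFn (q : ℤ) (u s)) ∞ volume) t ht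
    _ = (⨆ s ∈ Ioo t₀ T, eLpNorm (blockFn (q : ℤ) (u s)) ∞ volume) * ENNReal.ofReal (T - t₀) := by
        rw [setLIntegral_const, Real.volume_Ioo]

/-- **Maximal-solution form of the tail floor and the gauge reading** (`IsMaximalSmoothSolution ν 0 u p T`,
`ν ≥ 0`, BKM class on compact sub-intervals): for every `t₀ ∈ [0, T)`, every `J ∈ ℕ` and every summable
gauge `b`, `∑_{q} 2^{J+q} ∫_{(t₀,T)} ‖Δ̇_{J+q} u‖_∞ = ∞` and `b_q < 2^q ∫_{(t₀,T)} ‖Δ̇_q u‖_∞` at infinitely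
many `q`. [cite: BealeKatoMajda1984, Theorem 1] -/
theorem tail_and_gauge_of_maximal {ν : ℝ} (hν : 0 ≤ ν) {T : ℝ} (hT : 0 < T)
    {u : ℝ → EuclideanSpace ℝ (Fin 3) → EuclideanSpace ℝ (Fin 3)} {p : ℝ → EuclideanSpace ℝ (Fin 3) → ℝ}
    (hmax : IsMaximalSmoothSolution ν 0 u p T)
    (hreg : ∀ T'' < T, HasBoundedSobolevNormsOn (Icc 0 T'') u) {t₀ : ℝ} (ht₀ : t₀ ∈ Ico 0 T) :
    (∀ J : ℕ, ∑' q : ℕ, (2 : ℝ≥0∞) ^ (J + q) *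
        ∫⁻ t in Ioo t₀ T, eLpNorm (blockFn ((J + q : ℕ) : ℤ) (u t)) ∞ volume = ∞) ∧
    ∀ b : ℕ → ℝ≥0∞, ∑' q, b q ≠ ∞ →
      ∃ᶠ q : ℕ in atTop, b q < (2 : ℝ≥0∞) ^ q * ∫⁻ t in Ioo t₀ T, eLpNorm (blockFn (q : ℤ) (u t)) ∞ volume :=
  have hmax' : ¬ HasSobolevExtensionPast ν u T := fun hext => hmax.2 hext.hasSmoothExtensionPast
  ⟨fun J => tsum_occupation_tail_eq_top_nat hν hT hmax.1 hreg hmax' ht₀ J,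
    fun _ hb => frequently_lt_occupation hν hT hmax.1 hreg hmax' ht₀ hb⟩

end Summit.NavierStokesRegularity.FluidComputer.SummedOccupationFloor

end
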